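import Literature.NumberTheory.EllipticCurves.IwasawaEulerCharProofs
import HarnessLib

/-!
# Freeness of a torsion-free `Λ = ℤ_p⟦T⟧`-module whose coinvariants are free: the basis-lifting
# criterion (proofs only)

Topic `NumberTheory/EllipticCurves` (Iwasawa-algebra module theory; sibling of
`IwasawaEulerCharProofs.lean`, whose `TSubmodule p M = T·M` / `coinvariants p M = M/TM` it uses).
THEOREMS ONLY, no new definitions, nothing asserted as a fact.

The criterion (Bourbaki, *Algèbre commutative* II §3 no. 2 Prop. 5 with Nakayama, or Washington
§13.3 in the Iwasawa setting; used constantly to prove that Iwasawa cohomology groups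
`H¹_Iw = lim H¹(ℤ[ζ_{pⁿ},1/p], T)` are free, e.g. Kato, Astérisque 295 Thm. 12.4 (3) via 13.8, and in
cell `bsd-potss`'s reading `TorsionFree.RealizableOfKMC`): **if `M` is a `Λ`-module without
`T`-torsion, and a finite family `s : ι → M` reduces modulo `T·M` to a `ℤ_p`-basis of `M/TM` — i.e.
its span plus `T·M` is all of `M` (with `M` finitely generated) and no non-trivial `ℤ_p`-combination
`∑ C(cᵢ)·sᵢ` lies in `T·M` — then `s` is a `Λ`-BASIS of `M`; in particular `M` is free.**
Spanning is Nakayama (`T` lies in the Jacobson radical of the local ring `Λ`; Mathlib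
`Submodule.le_of_le_smul_of_le_jacobson_bot`); linear independence is `T`-adic division: a relation
`∑ fᵢ·sᵢ = 0` with every `fᵢ ∈ (Tᵈ)` gives, after cancelling `Tᵈ` (no `T`-torsion) and reducing
modulo `T`, a `ℤ_p`-relation in `M/TM`, so every `fᵢ ∈ (T^{d+1})`; hence `fᵢ ∈ ⋂_d (Tᵈ) = 0`.
Consequence recorded for the cell: a finitely generated torsion-free `Λ`-module whose coinvariants
`M/TM` are `ℤ_p`-torsion-free (hence `ℤ_p`-free of finite rank, `ℤ_p` a PID) is `Λ`-free — the step
"`𝐇¹(T)⁰` is free when `p ∤ #E(ℚ)_tors`" of `Summits/…/Additive/KatoDescentTorsionFreeReadings.lean`.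

References: N. Bourbaki, *Algèbre commutative* Ch. II §3 no. 2, Prop. 5 and Cor. 2 [BourbakiAC5to7];
L. C. Washington, *Introduction to Cyclotomic Fields*, §13.3 (Nakayama for `Λ`-modules) [Washington1997];
K. Kato, Astérisque 295 (2004) 13.8 (p. 228: the regular-sequence argument for `𝐇¹(T)`) [Kato2004Asterisque].
-/

set_option autoImplicit false

noncomputable section

open scoped Classical

open PowerSeries

namespace Literature.NumberTheory.EllipticCurves.IwasawaAlgebra

variable {p : ℕ} [Fact p.Prime]
variable {M : Type*} [AddCommGroup M] [Module (IwasawaAlgebra p) M]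

/-- `T` lies in the Jacobson radical of `Λ = ℤ_p⟦T⟧` (a local ring; `T` is not a unit since its
constant coefficient vanishes) — the hypothesis of Nakayama's lemma for `Λ`.
[cite: Washington1997, §13.3 Lemma 13.16] [cite: BourbakiAC5to7, Ch. II §3 no. 2 Prop. 4] -/
theorem span_X_le_jacobson_bot :
    Ideal.span {(X : IwasawaAlgebra p)} ≤ (⊥ : Ideal (IwasawaAlgebra p)).jacobson := by
  rw [IsLocalRing.jacobson_eq_maximalIdeal ⊥ bot_ne_top, Ideal.span_le, Set.singleton_subset_iff]
  change (X : IwasawaAlgebra p) ∈ IsLocalRing.maximalIdeal (IwasawaAlgebra p)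
  rw [IsLocalRing.mem_maximalIdeal, mem_nonunits_iff, PowerSeries.isUnit_iff_constantCoeff]
  simp

/-- **Nakayama for `Λ`-modules: a family spanning `M/TM` spans `M`** (`M` finitely generated).
[cite: Washington1997, §13.3 Lemma 13.16] [cite: BourbakiAC5to7, Ch. II §3 no. 2 Cor. 2 of Prop. 4] -/
theorem span_eq_top_of_span_sup_TSubmodule [Module.Finite (IwasawaAlgebra p) M] {ι : Type*}
    (s : ι → M) (h : Submodule.span (IwasawaAlgebra p) (Set.range s) ⊔ TSubmodule p M = ⊤) :
    Submodule.span (IwasawaAlgebra p) (Set.range s) = ⊤ := by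
  refine top_le_iff.mp (Submodule.le_of_le_smul_of_le_jacobson_bot Module.Finite.fg_top
    span_X_le_jacobson_bot ?_)
  rw [h]

/-- The `T`-adic division step: if `∑ᵢ gᵢ • sᵢ = 0` and no non-trivial `ℤ_p`-combination of the
`sᵢ` lies in `T·M`, then every `gᵢ` is divisible by `T` (reduce the relation modulo `T`:
`gᵢ = T·hᵢ + C(gᵢ(0))`). [cite: BourbakiAC5to7, Ch. II §3 no. 2 Prop. 5] -/
theorem X_dvd_of_sum_smul_eq_zero {ι : Type*} [Fintype ι] (s : ι → M)
    (hli : ∀ c : ι → ℤ_[p],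
      (∑ i, (C (c i) : IwasawaAlgebra p) • s i) ∈ TSubmodule p M → ∀ i, c i = 0)
    (g : ι → IwasawaAlgebra p) (hg : ∑ i, g i • s i = 0) (i : ι) :
    (X : IwasawaAlgebra p) ∣ g i := by
  -- split off the constant coefficients
  set h : ι → IwasawaAlgebra p := fun j ↦ PowerSeries.mk fun n ↦ coeff (n + 1) (g j) with hh
  have hdec : ∀ j, g j = X * h j + C (constantCoeff (g j)) := fun j ↦ eq_X_mul_shift_add_const (g j)
  have hmem : (∑ j, (C (constantCoeff (g j)) : IwasawaAlgebra p) • s j) ∈ TSubmodule p M := by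
    have hsum : (∑ j, (C (constantCoeff (g j)) : IwasawaAlgebra p) • s j) =
        -((X : IwasawaAlgebra p) • ∑ j, h j • s j) := by
      rw [eq_neg_iff_add_eq_zero, Finset.smul_sum, ← Finset.sum_add_distrib, ← hg]
      refine Finset.sum_congr rfl fun j _ ↦ ?_
      rw [← mul_smul, ← add_smul, add_comm, ← hdec j]
    rw [hsum]
    exact Submodule.neg_mem _ (X_smul_mem_TSubmodule p M _)
  have hc := hli (fun j ↦ constantCoeff (g j)) hmem i
  rw [X_dvd_iff, hc]

/-- **`T`-adic lifting of linear independence: a family whose reduction modulo `T·M` is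
`ℤ_p`-linearly independent is `Λ`-linearly independent, provided `M` has no `T`-torsion.**
(Any relation `∑ fᵢ • sᵢ = 0` has all `fᵢ ∈ (Tᵈ)` for every `d`, by induction using the division
step and cancellation of `T`; and `⋂_d (Tᵈ) = 0`.) [cite: BourbakiAC5to7, Ch. II §3 no. 2 Prop. 5] -/
theorem linearIndependent_of_coinvariants {ι : Type*} [Fintype ι] (s : ι → M)
    (htf : ∀ m : M, (X : IwasawaAlgebra p) • m = 0 → m = 0)
    (hli : ∀ c : ι → ℤ_[p],
      (∑ i, (C (c i) : IwasawaAlgebra p) • s i) ∈ TSubmodule p M → ∀ i, c i = 0) :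
    LinearIndependent (IwasawaAlgebra p) s := by
  rw [Fintype.linearIndependent_iff]
  intro f hf
  -- every `f i` is divisible by every power of `T`
  have key : ∀ d : ℕ, ∀ g : ι → IwasawaAlgebra p, ∑ i, g i • s i = 0 →
      ∀ i, (X : IwasawaAlgebra p) ^ d ∣ g i := by
    intro d
    induction d with
    | zero => intro g _ i; simp
    | succ d ih =>
      intro g hg i
      -- write `g j = X^d * g' j`
      have hdvd := ih g hg
      choose g' hg' using hdvd
      have hg'sum : ∑ j, g' j • s j = 0 := by
        have hX : (X : IwasawaAlgebra p) ^ d • ∑ j, g' j • s j = 0 := by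
          rw [Finset.smul_sum, ← hg]
          refine Finset.sum_congr rfl fun j _ ↦ ?_
          rw [← mul_smul, ← hg' j]
        -- cancel `X^d` (no `T`-torsion, by induction on `d`)
        have hcancel : ∀ (e : ℕ) (m : M), (X : IwasawaAlgebra p) ^ e • m = 0 → m = 0 := by
          intro e
          induction e with
          | zero => intro m hm; simpa using hm
          | succ e ihe =>
            intro m hm
            rw [pow_succ, mul_smul] at hm
            exact htf m (ihe _ hm)
        exact hcancel d _ hX
      have hXdvd : (X : IwasawaAlgebra p) ∣ g' i := X_dvd_of_sum_smul_eq_zero s hli g' hg'sum i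
      obtain ⟨q, hq⟩ := hXdvd
      refine ⟨q, ?_⟩
      rw [hg' i, hq, pow_succ, mul_assoc]
  intro i
  ext n
  have hdvd : (X : IwasawaAlgebra p) ^ (n + 1) ∣ f i := key (n + 1) f hf i
  rw [X_pow_dvd_iff] at hdvd
  rw [hdvd n (Nat.lt_succ_self n), map_zero]

/-- **The basis-lifting criterion**: `M` finitely generated over `Λ = ℤ_p⟦T⟧` without `T`-torsion,
`s : ι → M` a finite family that spans `M` modulo `T·M` and is `ℤ_p`-linearly independent modulo
`T·M` ⟹ `s` spans `M` and is `Λ`-linearly independent, i.e. a `Λ`-basis.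
[cite: BourbakiAC5to7, Ch. II §3 no. 2 Prop. 5] [cite: Washington1997, §13.3] -/
theorem linearIndependent_and_span_eq_top_of_coinvariants [Module.Finite (IwasawaAlgebra p) M]
    {ι : Type*} [Fintype ι] (s : ι → M)
    (htf : ∀ m : M, (X : IwasawaAlgebra p) • m = 0 → m = 0)
    (hspan : Submodule.span (IwasawaAlgebra p) (Set.range s) ⊔ TSubmodule p M = ⊤)
    (hli : ∀ c : ι → ℤ_[p],
      (∑ i, (C (c i) : IwasawaAlgebra p) • s i) ∈ TSubmodule p M → ∀ i, c i = 0) :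
    LinearIndependent (IwasawaAlgebra p) s ∧
      Submodule.span (IwasawaAlgebra p) (Set.range s) = ⊤ :=
  ⟨linearIndependent_of_coinvariants s htf hli, span_eq_top_of_span_sup_TSubmodule s hspan⟩

/-- **Freeness**: under the hypotheses of the criterion, `M` is a FREE `Λ`-module (with basis `s`).
This is the algebra step "a finitely generated torsion-free `Λ`-module with `ℤ_p`-torsion-free
coinvariants is free" (choose `s` lifting a `ℤ_p`-basis of the coinvariants) of the reading
`TorsionFree.RealizableOfKMC` (freeness of `𝐇¹(T)⁰` when `p ∤ #E(ℚ)_tors`).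
[cite: BourbakiAC5to7, Ch. II §3 no. 2 Prop. 5] [cite: Kato2004Asterisque, Thm. 12.4 (3) and 13.8 (p. 228)] -/
theorem free_of_coinvariants [Module.Finite (IwasawaAlgebra p) M] {ι : Type*} [Fintype ι]
    (s : ι → M) (htf : ∀ m : M, (X : IwasawaAlgebra p) • m = 0 → m = 0)
    (hspan : Submodule.span (IwasawaAlgebra p) (Set.range s) ⊔ TSubmodule p M = ⊤)
    (hli : ∀ c : ι → ℤ_[p],
      (∑ i, (C (c i) : IwasawaAlgebra p) • s i) ∈ TSubmodule p M → ∀ i, c i = 0) :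
    Module.Free (IwasawaAlgebra p) M := by
  obtain ⟨hind, hsp⟩ := linearIndependent_and_span_eq_top_of_coinvariants s htf hspan hli
  exact Module.Free.of_basis (Module.Basis.mk hind (by rw [hsp]))

/-- The no-`T`-torsion hypothesis in the form the cell's data carry it (`NoZeroSMulDivisors Λ M`,
e.g. `KatoDescentDatum.tfH` for `𝐇¹(T)⁰`, Kato Thm. 12.4 (2)). [cite: Kato2004Asterisque, Thm. 12.4 (2) (p. 221)] -/
theorem free_of_coinvariants' [Module.Finite (IwasawaAlgebra p) M]
    [NoZeroSMulDivisors (IwasawaAlgebra p) M] {ι : Type*} [Fintype ι] (s : ι → M)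
    (hspan : Submodule.span (IwasawaAlgebra p) (Set.range s) ⊔ TSubmodule p M = ⊤)
    (hli : ∀ c : ι → ℤ_[p],
      (∑ i, (C (c i) : IwasawaAlgebra p) • s i) ∈ TSubmodule p M → ∀ i, c i = 0) :
    Module.Free (IwasawaAlgebra p) M :=
  free_of_coinvariants s
    (fun _ hm ↦ (smul_eq_zero.mp hm).resolve_left PowerSeries.X_ne_zero) hspan hli

end Literature.NumberTheory.EllipticCurves.IwasawaAlgebra

end
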